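import Mathlib
import Literature.Combinatorics.Optimization.DeKlerkPasechnikLovaszTheta
import HarnessLib

/-!
# Schrijver's `ϑ'`: the nonnegative strengthening of the Lovász theta number

"Recall that `ϑ(G) = max {⟨J, X⟩ : Tr(X) = 1, X_{ij} = 0 ({i,j} ∈ E), X ⪰ 0}`, and `ϑ'(G)` is
obtained by adding the nonnegativity constraint `X ≥ 0` to the above program. As is well-known we
have `α(G) ≤ ϑ'(G) ≤ ϑ(G) ≤ χ(Ḡ)`" [cite: LaurentVargas2022, §1 ((1.5) and the paragraph before
it)]; the parameter `ϑ'` is "the strengthening of the theta number `ϑ(G)` by Lovász, proposed in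
[Sch79]" [cite: LaurentVargas2022, §1] [cite: Schrijver1979]. Moreover "as shown in [dKP2002], the
parameter `ϑ^{(0)}(G)` coincides with `ϑ'(G)`" [cite: LaurentVargas2022, §1]
[cite: DeklerkPasechnik2002, §4] [cite: Gvozdenovic2008, §4.2.1 ((4.41): "for t = 0 the definition
coincides with (3.17), yielding ϑ̂^{(0)}(G) = ϑ^{(0)}(G) = ϑ'(G)")].

This file adds `ϑ'` on top of the tree's Lovász theta number
(`Literature.Combinatorics.SimpleGraph.LovaszTheta`: `IsThetaFeasible`, `entrySum`, `lovaszTheta`)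
and places it in the de Klerk–Pasechnik picture of
`Literature.Combinatorics.Optimization.DeKlerkPasechnikTheta` / `…LovaszTheta`.

## Contents

* `IsThetaPrimeFeasible G B`: `B ⪰ 0`, `Tr B = 1`, `B_{uv} = 0` on edges, **and `B ≥ 0`**;
  `schrijverTheta G = sup {𝟙ᵀB𝟙 : B feasible}` (a real supremum, bounded by `|V|`; for empty `V`
  the junk value `0`).
* `schrijverTheta_le_lovaszTheta : ϑ'(G) ≤ ϑ(G)`; `indepNum_le_schrijverTheta : α(G) ≤ ϑ'(G)`
  (the normalised indicator matrix `|S|⁻¹ 𝟙_S 𝟙_Sᵀ` of an independent set is nonnegative);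
  `schrijverTheta_anti` (monotone under edge deletion).
* **Weak duality half of `ϑ' = ϑ^{(0)}`**: `schrijverTheta_le_theta_zero : ϑ'(G) ≤ ϑ^{(0)}(G)`
  (from `DeKlerkPasechnikLovaszTheta.entrySum_le_theta_zero`); the reverse inequality is the cited
  strong-duality statement of [cite: DeklerkPasechnik2002, §4] and is not formalised here.
  Hence the refined sandwich `α ≤ ϑ' ≤ ϑ^{(0)} ≤ ϑ ≤ χ(Ḡ)` (`sandwich'`) and
  `schrijverTheta_eq_indepNum_of_colorable` (`ϑ' = α` when `Ḡ` is `α`-colourable).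
* **The pentagon**: Lovász's umbrella Gram matrix is entrywise nonnegative, so
  `schrijverTheta_cycleGraph_five : ϑ'(C₅) = √5 = ϑ(C₅) = ϑ^{(0)}(C₅)`
  [cite: Lovasz1979, Theorem 2] [cite: LaurentVargas2022, §1]; in particular
  `indepNum_lt_schrijverTheta_cycleGraph_five : α(C₅) = 2 < ϑ'(C₅)` (the nonnegativity
  constraint does not close the gap on `C₅`).
-/

noncomputable section

namespace Literature.Combinatorics.Optimization.SchrijverTheta

open Matrix Finset _root_.SimpleGraph
open Literature.Combinatorics.SimpleGraph
open Literature.Algebra.Polynomial.ParriloCopositiveSos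
open Literature.Combinatorics.Optimization.MotzkinStrausCopositive
open Literature.Combinatorics.Optimization.DeKlerkPasechnikTheta
open Literature.Combinatorics.Optimization.DeKlerkPasechnikThetaDual
open Literature.Combinatorics.Optimization.DeKlerkPasechnikLovaszTheta

variable {V : Type*} [Fintype V]

section General

/-- **Feasible matrices of Schrijver's programme for `ϑ'(G)`**: Lovász-feasible (`B ⪰ 0`,
`Tr B = 1`, `B_{uv} = 0` on edges of `G`) and entrywise nonnegative — "`ϑ'(G)` is obtained by
adding the nonnegativity constraint `X ≥ 0`" [cite: LaurentVargas2022, §1] [cite: Schrijver1979]. -/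
structure IsThetaPrimeFeasible (G : SimpleGraph V) (B : Matrix V V ℝ) : Prop
    extends IsThetaFeasible G B where
  /-- `B ≥ 0` entrywise -/
  nonneg : ∀ u v, 0 ≤ B u v

/-- **Schrijver's `ϑ'(G) = sup {⟨J, B⟩ : B ⪰ 0, Tr B = 1, B_{uv} = 0 (uv ∈ E), B ≥ 0}`**
[cite: LaurentVargas2022, §1 (ϑ')] [cite: Schrijver1979]. A real supremum over a set bounded by
`|V|`; for empty `V` the junk value `sSup ∅ = 0`. -/
def schrijverTheta (G : SimpleGraph V) : ℝ :=
  sSup (entrySum '' {B | IsThetaPrimeFeasible G B})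

variable (G : SimpleGraph V)

/-- The `ϑ'`-feasible values are among the `ϑ`-feasible values. [folklore] -/
@[folklore] private theorem thetaPrimeValues_subset :
    entrySum '' {B | IsThetaPrimeFeasible G B} ⊆ entrySum '' {B | IsThetaFeasible G B} := by
  rintro _ ⟨B, hB, rfl⟩
  exact ⟨B, hB.toIsThetaFeasible, rfl⟩

/-- The `ϑ'`-feasible values are bounded above (by `|V|`). [folklore] -/
@[folklore] private theorem bddAbove_thetaPrimeValues :
    BddAbove (entrySum '' {B | IsThetaPrimeFeasible G B}) :=
  (bddAbove_thetaValues G).mono (thetaPrimeValues_subset G)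

/-- `|V|⁻¹ I` is `ϑ'`-feasible (the programme is feasible on a nonempty vertex set)
[cite: LaurentVargas2022, §1 (ϑ')]. -/
theorem isThetaPrimeFeasible_smul_one [DecidableEq V] [Nonempty V] :
    IsThetaPrimeFeasible G ((Fintype.card V : ℝ)⁻¹ • (1 : Matrix V V ℝ)) where
  toIsThetaFeasible := isThetaFeasible_smul_one G
  nonneg u v := by
    rw [Matrix.smul_apply, smul_eq_mul, one_apply]
    split_ifs <;> simp

/-- Every feasible value is at most `ϑ'(G)` [cite: LaurentVargas2022, §1 (ϑ' as a maximum)]. -/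
theorem entrySum_le_schrijverTheta {B : Matrix V V ℝ} (hB : IsThetaPrimeFeasible G B) :
    entrySum B ≤ schrijverTheta G :=
  le_csSup (bddAbove_thetaPrimeValues G) ⟨B, hB, rfl⟩

/-- `0 ≤ ϑ'(G)` (all feasible values are sums of nonnegative entries; `sSup ∅ = 0`)
[cite: LaurentVargas2022, §1]. -/
theorem schrijverTheta_nonneg : 0 ≤ schrijverTheta G := by
  refine Real.sSup_nonneg ?_
  rintro _ ⟨B, hB, rfl⟩
  exact sum_nonneg fun u _ => sum_nonneg fun v _ => hB.nonneg u v

/-- **`ϑ'(G) ≤ ϑ(G)`** — adding a constraint can only lower the maximum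
[cite: LaurentVargas2022, §1 ((1.5))] [cite: Schrijver1979]. -/
theorem schrijverTheta_le_lovaszTheta [DecidableEq V] : schrijverTheta G ≤ lovaszTheta G := by
  refine Real.sSup_le ?_ (lovaszTheta_nonneg G)
  rintro _ ⟨B, hB, rfl⟩
  exact le_csSup (bddAbove_thetaValues G) ⟨B, hB.toIsThetaFeasible, rfl⟩

/-- `ϑ'(G) ≤ |V|` [cite: LaurentVargas2022, §1 ((1.5) with χ(Ḡ) ≤ |V|)]. -/
theorem schrijverTheta_le_card [DecidableEq V] : schrijverTheta G ≤ Fintype.card V :=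
  (schrijverTheta_le_lovaszTheta G).trans (lovaszTheta_le_card G)

/-- `ϑ'` is antitone in the graph: deleting edges relaxes the constraints `B_{uv} = 0`
[cite: LaurentVargas2022, §1 (ϑ')]. -/
theorem schrijverTheta_anti {H H' : SimpleGraph V} (hHH' : H' ≤ H) :
    schrijverTheta H ≤ schrijverTheta H' := by
  refine Real.sSup_le ?_ (schrijverTheta_nonneg H')
  rintro _ ⟨B, hB, rfl⟩
  exact entrySum_le_schrijverTheta H' ⟨hB.toIsThetaFeasible.anti hHH', hB.nonneg⟩

/-- The normalised indicator matrix `s⁻¹ 𝟙_S 𝟙_Sᵀ` of an independent `s`-set `S` is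
`ϑ'`-feasible with value `s` (it is the tree's clique matrix for `Ḡ`, and it is entrywise
nonnegative) [cite: LaurentVargas2022, §1 (α ≤ ϑ')] [cite: Lovasz1979]. -/
theorem isThetaPrimeFeasible_indepMatrix [DecidableEq V] {s : ℕ} {S : Finset V}
    (hS : G.IsNIndepSet s S) (hs : s ≠ 0) :
    IsThetaPrimeFeasible G ((s : ℝ)⁻¹ • vecMulVec (indVec S) (indVec S)) ∧
      entrySum ((s : ℝ)⁻¹ • vecMulVec (indVec S) (indVec S)) = s := by
  have hS' : Gᶜ.IsNClique s S := (isNClique_compl G).2 hS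
  obtain ⟨hfeas, hval⟩ := isThetaFeasible_cliqueMatrix hS' hs
  rw [compl_compl] at hfeas
  refine ⟨⟨hfeas, fun u v => ?_⟩, hval⟩
  simp only [Matrix.smul_apply, vecMulVec_apply, indVec, smul_eq_mul]
  split_ifs <;> simp

/-- An independent `s`-set gives `s ≤ ϑ'(G)` [cite: LaurentVargas2022, §1 (α ≤ ϑ')]. -/
theorem le_schrijverTheta_of_isNIndepSet [DecidableEq V] {s : ℕ} {S : Finset V}
    (hS : G.IsNIndepSet s S) : (s : ℝ) ≤ schrijverTheta G := by
  rcases eq_or_ne s 0 with rfl | hs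
  · rw [Nat.cast_zero]; exact schrijverTheta_nonneg G
  · obtain ⟨hfeas, hval⟩ := isThetaPrimeFeasible_indepMatrix G hS hs
    rw [← hval]
    exact entrySum_le_schrijverTheta G hfeas

/-- **`α(G) ≤ ϑ'(G)`** [cite: LaurentVargas2022, §1 ((1.5))] [cite: Schrijver1979]. -/
theorem indepNum_le_schrijverTheta [DecidableEq V] : (G.indepNum : ℝ) ≤ schrijverTheta G := by
  classical
  obtain ⟨S, hS⟩ := G.exists_isNIndepSet_indepNum
  exact le_schrijverTheta_of_isNIndepSet G hS

variable [DecidableEq V] [DecidableRel G.Adj]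

/-- **`ϑ'(G) ≤ ϑ^{(0)}(G)`** — the weak-duality half of "`ϑ^{(0)}(G)` coincides with `ϑ'(G)`"
[cite: LaurentVargas2022, §1] [cite: DeklerkPasechnik2002, §4] [cite: Gvozdenovic2008, §4.2.1
((4.40)–(4.41))]: every `ϑ'`-feasible `B` pairs nonnegatively with an order-0 certificate
`t(I + A_G) - J = P + N` (`DeKlerkPasechnikLovaszTheta.entrySum_le_theta_zero`). -/
theorem schrijverTheta_le_theta_zero [Nonempty V] : schrijverTheta G ≤ theta G 0 := by
  refine Real.sSup_le ?_ ((Nat.cast_nonneg _).trans (indepNum_le_theta G 0))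
  rintro _ ⟨B, hB, rfl⟩
  exact entrySum_le_theta_zero G hB.toIsThetaFeasible hB.nonneg

/-- **The refined sandwich** `α(G) ≤ ϑ'(G) ≤ ϑ^{(0)}(G)`, `ϑ^{(r)}(G) ≤ ϑ^{(0)}(G) ≤ ϑ(G) ≤ k`
for every `k`-colouring of `Ḡ` [cite: LaurentVargas2022, §1 ((1.4)–(1.5))]. -/
theorem sandwich' [Nonempty V] (r : ℕ) {k : ℕ} (hc : Gᶜ.Colorable k) :
    (G.indepNum : ℝ) ≤ schrijverTheta G ∧ schrijverTheta G ≤ theta G 0 ∧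
      theta G r ≤ theta G 0 ∧ theta G 0 ≤ lovaszTheta G ∧ lovaszTheta G ≤ k :=
  ⟨indepNum_le_schrijverTheta G, schrijverTheta_le_theta_zero G, theta_anti G (Nat.zero_le r),
    theta_le_lovaszTheta G 0, (sandwich G 0 hc).2.2⟩

/-- If `Ḡ` is `α(G)`-colourable (e.g. `G` perfect) the sandwich collapses: `ϑ'(G) = α(G)`
[cite: LaurentVargas2022, §1 ((1.5))]. -/
theorem schrijverTheta_eq_indepNum_of_colorable [Nonempty V] (hc : Gᶜ.Colorable G.indepNum) :
    schrijverTheta G = G.indepNum :=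
  le_antisymm ((schrijverTheta_le_theta_zero G).trans (theta_eq_indepNum_of_colorable G hc 0).le)
    (indepNum_le_schrijverTheta G)

end General

/-! ## The pentagon: `ϑ'(C₅) = √5` -/

section Pentagon

/-- The off-diagonal entry `(√5 - 1)/10` of Lovász's umbrella matrix. [folklore] -/
@[folklore] private def gc : ℝ := (Real.sqrt 5 - 1) / 10

/-- `1 ≤ √5`. [folklore] -/
@[folklore] private theorem one_le_sqrt_five : (1 : ℝ) ≤ Real.sqrt 5 := by
  have h := Real.sqrt_le_sqrt (show (1 : ℝ) ≤ 5 by norm_num)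
  rwa [Real.sqrt_one] at h

/-- `0 ≤ (√5 - 1)/10`. [folklore] -/
@[folklore] private theorem gc_nonneg : 0 ≤ gc :=
  div_nonneg (by linarith [one_le_sqrt_five]) (by norm_num)

/-- **Lovász's umbrella as a Gram matrix**: `B = (1/5)(I + ((√5 - 1)/2)·A_{C̄₅})`, the optimal
solution of the `ϑ`-program for `C₅` (`uᵢ = (c + ribs)`, `cᵀuᵢ = 5^{-1/4}`); it is entrywise
nonnegative, so it is also `ϑ'`-feasible. [folklore] -/
@[folklore] private def umbrella : Matrix (Fin 5) (Fin 5) ℝ :=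
  !![1/5, 0, gc, gc, 0;
     0, 1/5, 0, gc, gc;
     gc, 0, 1/5, 0, gc;
     gc, gc, 0, 1/5, 0;
     0, gc, gc, 0, 1/5]

/-- `B ⪰ 0`: with `b = (√5 - 1)/2` (so `b² = 1 - b`),
`5·xᵀBx = (x₀ + b x₂ + b x₃)² + (x₁ + b x₃ + b x₄)² + b (x₂ - b x₃ + x₄)²` — a rank-3 Gram
representation (the umbrella lives in `ℝ³`). [folklore] -/
@[folklore] private theorem umbrella_posSemidef : umbrella.PosSemidef := by
  refine PosSemidef.of_dotProduct_mulVec_nonneg ?_ fun x => ?_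
  · unfold Matrix.IsHermitian
    ext i j
    simp only [conjTranspose_apply, star_trivial]
    fin_cases i <;> fin_cases j <;> simp [umbrella]
  · have hs : Real.sqrt 5 ^ 2 = 5 := Real.sq_sqrt (by norm_num)
    have hb : 0 ≤ (Real.sqrt 5 - 1) / 2 := div_nonneg (by linarith [one_le_sqrt_five]) (by norm_num)
    have hq : star x ⬝ᵥ umbrella *ᵥ x =
        (1 / 5 : ℝ) * ((x 0 + (Real.sqrt 5 - 1) / 2 * x 2 + (Real.sqrt 5 - 1) / 2 * x 3) ^ 2
          + (x 1 + (Real.sqrt 5 - 1) / 2 * x 3 + (Real.sqrt 5 - 1) / 2 * x 4) ^ 2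
          + (Real.sqrt 5 - 1) / 2 * (x 2 - (Real.sqrt 5 - 1) / 2 * x 3 + x 4) ^ 2) := by
      simp [dotProduct, Matrix.mulVec, Fin.sum_univ_five, umbrella, gc]
      linear_combination ((1 / 5 : ℝ) * (-(1 / 4) * x 2 ^ 2 - (1 + Real.sqrt 5) / 8 * x 3 ^ 2
        - 1 / 4 * x 4 ^ 2)) * hs
    rw [hq]
    exact mul_nonneg (by norm_num) (add_nonneg (add_nonneg (sq_nonneg _) (sq_nonneg _))
      (mul_nonneg hb (sq_nonneg _)))

/-- `B ≥ 0` entrywise. [folklore] -/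
@[folklore] private theorem umbrella_nonneg (i j : Fin 5) : 0 ≤ umbrella i j := by
  have h := gc_nonneg
  fin_cases i <;> fin_cases j <;> simp [umbrella, h]

/-- `B` vanishes on the edges of `C₅`. [folklore] -/
@[folklore] private theorem umbrella_edges (i j : Fin 5) (h : (cycleGraph 5).Adj i j) :
    umbrella i j = 0 := by
  revert h
  fin_cases i <;> fin_cases j <;>
    first | (intro h; exact absurd h (by decide)) | (intro; simp [umbrella])

/-- `Tr B = 1`. [folklore] -/
@[folklore] private theorem umbrella_trace : umbrella.trace = 1 := by
  simp [Matrix.trace, Fin.sum_univ_five, umbrella]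
  norm_num

/-- `B` is theta-feasible for `C₅`. [folklore] -/
@[folklore] private theorem umbrella_isThetaFeasible : IsThetaFeasible (cycleGraph 5) umbrella :=
  ⟨umbrella_posSemidef, umbrella_trace, fun i j h => umbrella_edges i j h⟩

/-- `𝟙ᵀB𝟙 = 1 + 2·(√5 - 1)/2 = √5`. [folklore] -/
@[folklore] private theorem entrySum_umbrella : entrySum umbrella = Real.sqrt 5 := by
  simp [entrySum, Fin.sum_univ_five, umbrella, gc]
  ring

/-- The umbrella matrix is `ϑ'`-feasible for `C₅`. [folklore] -/
@[folklore] private theorem umbrella_isThetaPrimeFeasible :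
    IsThetaPrimeFeasible (cycleGraph 5) umbrella :=
  ⟨umbrella_isThetaFeasible, umbrella_nonneg⟩

/-- **`√5 ≤ ϑ'(C₅)`**: Lovász's umbrella Gram matrix `(1/5)(I + ((√5-1)/2) A_{C̄₅})` is entrywise
nonnegative, hence `ϑ'`-feasible, with value `√5` [cite: Lovasz1979, Theorem 2 (p. 2)]
[cite: LaurentVargas2022, §1 (ϑ^{(0)} = ϑ')]. -/
theorem sqrt_five_le_schrijverTheta_cycleGraph_five :
    Real.sqrt 5 ≤ schrijverTheta (cycleGraph 5) := by
  rw [← entrySum_umbrella]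
  exact entrySum_le_schrijverTheta _ umbrella_isThetaPrimeFeasible

/-- **`ϑ'(C₅) = √5`** (`= ϑ(C₅) = ϑ^{(0)}(C₅)`): the upper bound is `ϑ' ≤ ϑ^{(0)}` and
`DeKlerkPasechnikLovaszTheta.theta_zero_cycleGraph_five` [cite: Lovasz1979, Theorem 2 (p. 2)]
[cite: LaurentVargas2022, §1 (ϑ^{(0)}(G) coincides with ϑ'(G))]. -/
theorem schrijverTheta_cycleGraph_five : schrijverTheta (cycleGraph 5) = Real.sqrt 5 :=
  le_antisymm ((schrijverTheta_le_theta_zero _).trans (theta_zero_cycleGraph_five).le)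
    sqrt_five_le_schrijverTheta_cycleGraph_five

/-- `ϑ'(C₅) = ϑ(C₅)` [cite: Lovasz1979, Theorem 2 (p. 2)] [cite: LaurentVargas2022, §1]. -/
theorem schrijverTheta_cycleGraph_five_eq_lovaszTheta :
    schrijverTheta (cycleGraph 5) = lovaszTheta (cycleGraph 5) := by
  rw [schrijverTheta_cycleGraph_five, lovaszTheta_cycleGraph_five]

/-- `ϑ'(C₅) = ϑ^{(0)}(C₅)` — the equality `ϑ' = ϑ^{(0)}` of [cite: DeklerkPasechnik2002, §4]
[cite: LaurentVargas2022, §1], verified on the pentagon. -/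
theorem schrijverTheta_cycleGraph_five_eq_theta_zero :
    schrijverTheta (cycleGraph 5) = theta (cycleGraph 5) 0 := by
  rw [schrijverTheta_cycleGraph_five, theta_zero_cycleGraph_five]

/-- **`α(C₅) = 2 < √5 = ϑ'(C₅)`**: the nonnegativity constraint does not make the bound exact on
the pentagon [cite: LaurentVargas2022, §1 (ϑ^{(0)}(C₅) = √5 > α(C₅), C₅ has ϑ-rank 1)]. -/
theorem indepNum_lt_schrijverTheta_cycleGraph_five :
    ((cycleGraph 5).indepNum : ℝ) < schrijverTheta (cycleGraph 5) := by
  rw [schrijverTheta_cycleGraph_five_eq_theta_zero]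
  exact indepNum_lt_theta_zero_cycleGraph_five

end Pentagon

end Literature.Combinatorics.Optimization.SchrijverTheta
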